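import Literature.Analysis.FluidPDE.SereginSverak2002FinalEnergy
import HarnessLib

/-!
# One-sided pressure bounds: regularity of a top point ⇔ no scaled energy concentration of the final value

Analysis/FluidPDE proof file (theorems only; no definitions, no named facts), sequel of
`SereginSverak2002FinalEnergy.lean` (G. Seregin, V. Šverák, Arch. Ration. Mech. Anal. **163**
(2002) 65–86, Thm. 2.2). It closes the circle around the final-time input (FE) of that file:
for a classical solution on `[0, T) × ℝ³` (`ν > 0`), Leray–Hopf on `[0, T]`, under EITHER
one-sided pressure bound on `(0, T) × ℝ³`, a top point `(T, x₀)` is backward bounded IF AND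
ONLY IF the final value `u(T)` has no scaled energy concentration at `x₀`,
`r⁻¹ ∫_{B(x₀,r)} ‖u(T)‖² → 0` (`isBackwardBoundedAt_top_iff_tendsto_scaledEnergy`). The direction
"⇐" is `isBackwardBoundedAt_of_scaledEnergy_at` (the prequel's theorem with the hypothesis at the
one point `x₀` only); "⇒" holds for every Leray–Hopf field: a bound `‖u‖ ≤ C` on a backward
cylinder `(T - r², T) × B(x₀, r)` passes to the weak `L²` trace, `∫_{B(x₀,ρ)} ‖u(T)‖² ≤ C² |B_ρ|`
for `ρ ≤ r` (`setIntegral_ball_norm_sq_final_le_of_bound`, duality against `1_B u(T)` as in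
`setIntegral_ball_norm_sq_final_le`), whence `ρ⁻¹ ∫_{B(x₀,ρ)} ‖u(T)‖² ≤ C² |B₁| ρ² → 0`.

So the head-ceiling half of the named fact `seregin_sverak_2002` on `(0, T)` alone (not covered by
the source, see `SereginSverak2002FinalMoment.lean`) is EQUIVALENT to the statement that a head
ceiling on `(0, T) × ℝ³` forbids scaled energy concentration of `u(T)`.

## References

* G. Seregin, V. Šverák, Arch. Ration. Mech. Anal. 163 (2002) 65–86: Thm. 2.2 (p. 70), §4 (4.8),
  (4.13) at `t₀` (pp. 80–84). [SereginSverak2002]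
-/

noncomputable section

open MeasureTheory TopologicalSpace Set Function Filter Topology Metric InnerProductSpace Real
open scoped ENNReal NNReal RealInnerProductSpace ContDiff

namespace Literature.Analysis.FluidPDE

namespace SereginSverak2002

variable {T : ℝ} {u : ℝ → EuclideanSpace ℝ (Fin 3) → EuclideanSpace ℝ (Fin 3)}
  {p : ℝ → EuclideanSpace ℝ (Fin 3) → ℝ}

/-! ### A backward bound passes to the final value -/

/-- **A uniform bound on a backward cylinder passes to the weak `L²` trace**: if `‖u(t,x)‖ ≤ C`
for `t ∈ (T - r², T)`, `x ∈ B(x₀, r)`, and `u` is Leray–Hopf on `[0, T]`, then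
`∫_{B(x₀,ρ)} ‖u(T)‖² ≤ C² |B(x₀, ρ)|` for `0 < ρ ≤ r` (test the weak continuity at `T` against
`1_{B(x₀,ρ)} u(T)`). [folklore] -/
theorem setIntegral_ball_norm_sq_final_le_of_bound {ν : ℝ} (hT : 0 < T)
    (hLH : IsLerayHopfOn T ν 0 (u 0) u) {x₀ : EuclideanSpace ℝ (Fin 3)} {r C : ℝ}
    (hC : ∀ t ∈ Ioo (T - r ^ 2) T, ∀ x ∈ ball x₀ r, ‖u t x‖ ≤ C)
    {ρ : ℝ} (hρ : 0 < ρ) (hρr : ρ ≤ r) :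
    ∫ x in ball x₀ ρ, ‖u T x‖ ^ 2 ≤ C ^ 2 * volume.real (ball x₀ ρ) := by
  set M : ℝ := C ^ 2 * volume.real (ball x₀ ρ) with hM
  have hr : 0 < r := hρ.trans_le hρr
  have hTI : T ∈ Icc 0 T := ⟨hT.le, le_rfl⟩
  have hbmem : MemLp (u T) 2 volume := hLH.memLp T hTI
  have hbm : AEStronglyMeasurable (u T) volume := hbmem.aestronglyMeasurable
  have hbL2 : Integrable fun x => ‖u T x‖ ^ 2 := hbmem.integrable_norm_pow two_ne_zero
  -- the test field `h = 1_B u(T)`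
  set h : EuclideanSpace ℝ (Fin 3) → EuclideanSpace ℝ (Fin 3) := (ball x₀ ρ).indicator (u T) with hh
  have hhmem : MemLp h 2 volume := hbmem.indicator measurableSet_ball
  have hcont := (hLH.weak_continuous h hhmem).1
  have hpair : ∀ v : EuclideanSpace ℝ (Fin 3) → EuclideanSpace ℝ (Fin 3),
      ∫ x, ⟪v x, h x⟫ = ∫ x in ball x₀ ρ, ⟪v x, u T x⟫ := by
    intro v
    rw [← integral_indicator measurableSet_ball]
    refine integral_congr_ae (Eventually.of_forall fun x => ?_)
    simp only [hh]
    by_cases hx : x ∈ ball x₀ ρ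
    · rw [indicator_of_mem hx, indicator_of_mem hx]
    · rw [indicator_of_notMem hx, indicator_of_notMem hx, inner_zero_right]
  -- for `t ∈ (max 0 (T - r²), T)`: `2∫_B ⟪u t, u T⟫ - ∫_B |u T|² ≤ ∫_B |u t|² ≤ M`
  have hineq : ∀ t ∈ Ioo (max 0 (T - r ^ 2)) T,
      2 * (∫ x, ⟪u t x, h x⟫) - ∫ x in ball x₀ ρ, ‖u T x‖ ^ 2 ≤ M := by
    intro t ht
    have ht0 : 0 < t := lt_of_le_of_lt (le_max_left _ _) ht.1
    have htr : t ∈ Ioo (T - r ^ 2) T := ⟨lt_of_le_of_lt (le_max_right _ _) ht.1, ht.2⟩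
    have htI : t ∈ Icc 0 T := ⟨ht0.le, ht.2.le⟩
    have hut : MemLp (u t) 2 volume := hLH.memLp t htI
    have hutL2 : Integrable fun x => ‖u t x‖ ^ 2 := hut.integrable_norm_pow two_ne_zero
    -- the pointwise bound on the ball
    have hMor : ∫ x in ball x₀ ρ, ‖u t x‖ ^ 2 ≤ M := by
      have h1 : ∫ x in ball x₀ ρ, ‖u t x‖ ^ 2 ≤ ∫ x in ball x₀ ρ, C ^ 2 := by
        refine setIntegral_mono_on hutL2.integrableOn (integrableOn_const measure_ball_lt_top.ne)
          measurableSet_ball fun x hx => ?_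
        exact pow_le_pow_left₀ (norm_nonneg _) (hC t htr x (ball_subset_ball hρr hx)) 2
      rw [setIntegral_const, smul_eq_mul, mul_comm] at h1
      exact h1
    rw [hpair]
    have hcross : IntegrableOn (fun x => ⟪u t x, u T x⟫) (ball x₀ ρ) := by
      have ib : Integrable (fun x => (‖u t x‖ ^ 2 + ‖u T x‖ ^ 2) / 2) volume := (hutL2.add hbL2).div_const 2
      refine Integrable.mono' ib.integrableOn
        ((hut.aestronglyMeasurable.inner hbm).restrict) (Eventually.of_forall fun x => ?_)
      rw [Real.norm_eq_abs]
      have h1 := abs_real_inner_le_norm (u t x) (u T x)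
      nlinarith [sq_nonneg (‖u t x‖ - ‖u T x‖)]
    have hkey : 2 * (∫ x in ball x₀ ρ, ⟪u t x, u T x⟫) - ∫ x in ball x₀ ρ, ‖u T x‖ ^ 2 ≤
        ∫ x in ball x₀ ρ, ‖u t x‖ ^ 2 := by
      rw [← integral_const_mul, ← integral_sub (hcross.const_mul 2) hbL2.integrableOn]
      refine setIntegral_mono_on ((hcross.const_mul 2).sub hbL2.integrableOn) hutL2.integrableOn
        measurableSet_ball fun x _ => ?_
      have := norm_sub_sq_real (u t x) (u T x)
      nlinarith [sq_nonneg ‖u t x - u T x‖, this]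
    exact hkey.trans hMor
  -- pass to the limit `t → T⁻`
  have hmax : max 0 (T - r ^ 2) < T := max_lt hT (by nlinarith)
  have h1 : ContinuousWithinAt (fun t => ∫ x, ⟪u t x, h x⟫) (Ioc 0 T) T := hcont T ⟨hT, le_rfl⟩
  have h2 : Tendsto (fun t => ∫ x, ⟪u t x, h x⟫) (𝓝[<] T) (𝓝 (∫ x, ⟪u T x, h x⟫)) := by
    have h' : Tendsto (fun t => ∫ x, ⟪u t x, h x⟫) (𝓝[Ioc 0 T] T) (𝓝 (∫ x, ⟪u T x, h x⟫)) := h1.tendsto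
    rw [nhdsWithin_Ioc_eq_nhdsLE hT] at h'
    exact h'.mono_left (nhdsWithin_mono _ Iio_subset_Iic_self)
  have hev : ∀ᶠ t in 𝓝[<] T, 2 * (∫ x, ⟪u t x, h x⟫) - ∫ x in ball x₀ ρ, ‖u T x‖ ^ 2 ≤ M := by
    filter_upwards [Ioo_mem_nhdsLT hmax] with t ht using hineq t ht
  have hlim := le_of_tendsto ((h2.const_mul 2).sub_const (∫ x in ball x₀ ρ, ‖u T x‖ ^ 2)) hev
  rw [hpair] at hlim
  have hself : ∫ x in ball x₀ ρ, ⟪u T x, u T x⟫ = ∫ x in ball x₀ ρ, ‖u T x‖ ^ 2 := by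
    refine integral_congr_ae (Eventually.of_forall fun x => ?_)
    exact real_inner_self_eq_norm_sq _
  rw [hself] at hlim
  linarith

/-- **Backward boundedness at `(T, x₀)` forbids scaled energy concentration of the final value at
`x₀`**: `ρ⁻¹ ∫_{B(x₀,ρ)} ‖u(T)‖² ≤ C² |B₁| ρ² → 0`. [folklore] -/
theorem tendsto_scaledEnergy_final_of_isBackwardBoundedAt {ν : ℝ} (hT : 0 < T)
    (hLH : IsLerayHopfOn T ν 0 (u 0) u) {x₀ : EuclideanSpace ℝ (Fin 3)}
    (hB : IsBackwardBoundedAt u T x₀) :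
    Tendsto (fun r : ℝ => r⁻¹ * ∫ x in ball x₀ r, ‖u T x‖ ^ 2) (𝓝[>] 0) (𝓝 0) := by
  obtain ⟨r, hr, C, hC⟩ := hB
  set V : ℝ := volume.real (ball (0 : EuclideanSpace ℝ (Fin 3)) 1) with hV
  have hV0 : 0 ≤ V := measureReal_nonneg
  -- the comparison function `C² V ρ²`
  have hup : Tendsto (fun ρ : ℝ => C ^ 2 * V * ρ ^ 2) (𝓝[>] 0) (𝓝 0) := by
    have h1 : Tendsto (fun ρ : ℝ => C ^ 2 * V * ρ ^ 2) (𝓝 0) (𝓝 (C ^ 2 * V * 0 ^ 2)) :=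
      ((continuous_const.mul (continuous_pow 2)).tendsto 0)
    rw [zero_pow two_ne_zero, mul_zero] at h1
    exact h1.mono_left nhdsWithin_le_nhds
  refine tendsto_of_tendsto_of_tendsto_of_le_of_le' tendsto_const_nhds hup ?_ ?_
  · filter_upwards [self_mem_nhdsWithin] with ρ hρ
    exact mul_nonneg (inv_nonneg.2 (le_of_lt hρ)) (integral_nonneg fun x => sq_nonneg _)
  · filter_upwards [Ioo_mem_nhdsGT hr] with ρ hρ
    have hvol : volume.real (ball x₀ ρ) = ρ ^ 3 * V := by
      rw [hV, measureReal_def, measureReal_def, Measure.addHaar_ball volume x₀ hρ.1.le,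
        finrank_euclideanSpace_fin, ENNReal.toReal_mul, ENNReal.toReal_ofReal (pow_nonneg hρ.1.le 3)]
    have h1 := setIntegral_ball_norm_sq_final_le_of_bound hT hLH hC hρ.1 hρ.2.le
    rw [hvol] at h1
    calc ρ⁻¹ * ∫ x in ball x₀ ρ, ‖u T x‖ ^ 2 ≤ ρ⁻¹ * (C ^ 2 * (ρ ^ 3 * V)) :=
          mul_le_mul_of_nonneg_left h1 (inv_nonneg.2 hρ.1.le)
      _ = C ^ 2 * V * ρ ^ 2 := by field_simp

/-! ### The converse at one point, every viscosity -/

/-- **Regularity of `(T, x₀)` under either one-sided bound when the final value has no scaled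
energy concentration at the point `x₀`, every viscosity** (the prequel's
`isBackwardBoundedAt_of_scaledEnergy` with the hypothesis at `x₀` only; same proof, viscosity
rescaling to `ν = 1`). [cite: SereginSverak2002, Thm. 2.2 (p. 70); (4.8) at t₀] -/
theorem isBackwardBoundedAt_top_of_scaledEnergy_at {ν : ℝ} (hν : 0 < ν) (hT : 0 < T)
    (hsol : IsClassicalNSSolutionOn (Ico 0 T) ν 0 u p) (hLH : IsLerayHopfOn T ν 0 (u 0) u)
    {K : ℝ}
    (hone : (∀ t ∈ Ioo 0 T, ∀ x, ‖u t x‖ ^ 2 / 2 + normalisedPressure (u t) x ≤ K) ∨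
      (∀ t ∈ Ioo 0 T, ∀ x, -K ≤ normalisedPressure (u t) x))
    (x₀ : EuclideanSpace ℝ (Fin 3))
    (hFE : Tendsto (fun r : ℝ => r⁻¹ * ∫ x in ball x₀ r, ‖u T x‖ ^ 2) (𝓝[>] 0) (𝓝 0)) :
    IsBackwardBoundedAt u T x₀ := by
  have hν0 : ν ≠ 0 := hν.ne'
  have hνi : 0 < ν⁻¹ := inv_pos.2 hν
  have hνT : 0 < ν * T := mul_pos hν hT
  set v : ℝ → EuclideanSpace ℝ (Fin 3) → EuclideanSpace ℝ (Fin 3) := timeRescale ν⁻¹ ν⁻¹ u with hv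
  set π' : ℝ → EuclideanSpace ℝ (Fin 3) → ℝ := timeRescale ν⁻¹ (ν⁻¹ ^ 2) p with hπ
  have hslice : ∀ s, v s = ν⁻¹ • u (ν⁻¹ * s) := fun s => rfl
  have hmaps : MapsTo (fun s => ν⁻¹ * s) (Ico 0 (ν * T)) (Ico 0 T) := by
    intro s hs'
    refine ⟨mul_nonneg hνi.le hs'.1, ?_⟩
    calc ν⁻¹ * s < ν⁻¹ * (ν * T) := mul_lt_mul_of_pos_left hs'.2 hνi
      _ = T := by rw [← mul_assoc, inv_mul_cancel₀ hν0, one_mul]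
  have hs' : IsClassicalNSSolutionOn (Ico 0 (ν * T)) 1 0 v π' := by
    have := hsol.viscosityRescale_set hν0 hmaps (uniqueDiffOn_Ico 0 (ν * T))
    rwa [timeRescale_zero_force] at this
  have hv0 : v 0 = ν⁻¹ • u 0 := by rw [hslice, mul_zero]
  have hLH' : IsLerayHopfOn (ν * T) 1 0 (v 0) v := by
    have := hLH.viscosityRescale hνi
    rw [div_inv_eq_mul, mul_comm T ν, inv_mul_cancel₀ hν0, timeRescale_zero_force] at this
    rwa [hv0]
  have hpress : ∀ s x, normalisedPressure (v s) x = ν⁻¹ ^ 2 * normalisedPressure (u (ν⁻¹ * s)) x :=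
    fun s x => by rw [hslice, normalisedPressure_smul]
  have hnorm : ∀ s x, ‖v s x‖ ^ 2 = ν⁻¹ ^ 2 * ‖u (ν⁻¹ * s) x‖ ^ 2 := fun s x => by
    rw [hslice, Pi.smul_apply, norm_smul, Real.norm_eq_abs, abs_of_pos hνi]; ring
  have hone' : (∀ s ∈ Ioo 0 (ν * T), ∀ x, ‖v s x‖ ^ 2 / 2 + normalisedPressure (v s) x ≤ ν⁻¹ ^ 2 * |K|) ∨
      (∀ s ∈ Ioo 0 (ν * T), ∀ x, -(ν⁻¹ ^ 2 * |K|) ≤ normalisedPressure (v s) x) := by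
    rcases hone with hhead | hfloor
    · refine Or.inl fun s hs'' x => ?_
      have ht : ν⁻¹ * s ∈ Ioo 0 T := (inv_mul_mem_Ioo_iff hν).2 hs''
      have h1 := hhead _ ht x
      have h2 : ‖u (ν⁻¹ * s) x‖ ^ 2 / 2 + normalisedPressure (u (ν⁻¹ * s)) x ≤ |K| :=
        h1.trans (le_abs_self K)
      have := mul_le_mul_of_nonneg_left h2 (sq_nonneg ν⁻¹)
      rw [hpress, hnorm]
      linarith
    · refine Or.inr fun s hs'' x => ?_
      have ht : ν⁻¹ * s ∈ Ioo 0 T := (inv_mul_mem_Ioo_iff hν).2 hs''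
      have h1 := hfloor _ ht x
      have h2 : -|K| ≤ normalisedPressure (u (ν⁻¹ * s)) x := (neg_le_neg (le_abs_self K)).trans h1
      have := mul_le_mul_of_nonneg_left h2 (sq_nonneg ν⁻¹)
      rw [hpress]
      linarith
  have hvT : v (ν * T) = ν⁻¹ • u T := by
    rw [hslice, ← mul_assoc, inv_mul_cancel₀ hν0, one_mul]
  have hFE' : Tendsto (fun r : ℝ => r⁻¹ * ∫ x in ball x₀ r, ‖v (ν * T) x‖ ^ 2) (𝓝[>] 0) (𝓝 0) := by
    rw [hvT]
    exact tendsto_scaledEnergy_const_smul hFE ν⁻¹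
  have hb := isBackwardBoundedAt_top_of_scaledEnergy hνT hs' hLH' (by positivity : (0 : ℝ) ≤ ν⁻¹ ^ 2 * |K|)
    hone' x₀ hFE'
  obtain ⟨r, hr, C, hC⟩ := hb
  set m : ℝ := max 1 ν with hm
  have hm1 : 1 ≤ m := le_max_left _ _
  have hmν : ν ≤ m := le_max_right _ _
  have hm0 : 0 < m := by positivity
  refine ⟨r / m, by positivity, ν * C, fun t ht x hx => ?_⟩
  have hrm : r / m ≤ r := div_le_self hr.le hm1
  have hts : ν * t ∈ Ioo (ν * T - r ^ 2) (ν * T) := by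
    constructor
    · have h1 : ν * (T - t) < ν * (r / m) ^ 2 := mul_lt_mul_of_pos_left (by linarith [ht.1]) hν
      have hsq : ν * (r / m) ^ 2 ≤ r ^ 2 := by
        rw [div_pow]
        have hm2 : ν ≤ m ^ 2 := hmν.trans (by nlinarith)
        calc ν * (r ^ 2 / m ^ 2) = ν / m ^ 2 * r ^ 2 := by ring
          _ ≤ 1 * r ^ 2 := by
              refine mul_le_mul_of_nonneg_right ?_ (sq_nonneg r)
              rw [div_le_one (by positivity)]; exact hm2
          _ = r ^ 2 := one_mul _
      nlinarith
    · exact mul_lt_mul_of_pos_left ht.2 hν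
  have hxs : x ∈ ball x₀ r := ball_subset_ball hrm hx
  have key := hC (ν * t) hts x hxs
  rw [hslice, Pi.smul_apply, ← mul_assoc, inv_mul_cancel₀ hν0, one_mul, norm_smul,
    Real.norm_eq_abs, abs_of_pos hνi] at key
  exact (inv_mul_le_iff₀ hν).1 key

/-- **Characterisation.** For a classical solution on `[0, T) × ℝ³` (`ν > 0`) which is Leray–Hopf
on `[0, T]`, under either one-sided pressure bound on `(0, T) × ℝ³`: the top point `(T, x₀)` is
backward bounded iff the final value has no scaled energy concentration at `x₀`,
`r⁻¹ ∫_{B(x₀,r)} ‖u(T)‖² → 0` as `r → 0⁺`. In particular the head-ceiling alternative of the named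
fact `seregin_sverak_2002` on `(0, T)` alone is equivalent to: a head ceiling on `(0, T) × ℝ³`
forbids scaled energy concentration of `u(T)`.
[cite: SereginSverak2002, Thm. 2.2 (p. 70); (4.8), (4.13) at t₀ (pp. 80–84)] -/
theorem isBackwardBoundedAt_top_iff_tendsto_scaledEnergy {ν : ℝ} (hν : 0 < ν) (hT : 0 < T)
    (hsol : IsClassicalNSSolutionOn (Ico 0 T) ν 0 u p) (hLH : IsLerayHopfOn T ν 0 (u 0) u)
    {K : ℝ}
    (hone : (∀ t ∈ Ioo 0 T, ∀ x, ‖u t x‖ ^ 2 / 2 + normalisedPressure (u t) x ≤ K) ∨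
      (∀ t ∈ Ioo 0 T, ∀ x, -K ≤ normalisedPressure (u t) x))
    (x₀ : EuclideanSpace ℝ (Fin 3)) :
    IsBackwardBoundedAt u T x₀ ↔
      Tendsto (fun r : ℝ => r⁻¹ * ∫ x in ball x₀ r, ‖u T x‖ ^ 2) (𝓝[>] 0) (𝓝 0) :=
  ⟨tendsto_scaledEnergy_final_of_isBackwardBoundedAt hT hLH,
    isBackwardBoundedAt_top_of_scaledEnergy_at hν hT hsol hLH hone x₀⟩

end SereginSverak2002

end Literature.Analysis.FluidPDE

end
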